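import Literature.NumberTheory.ModularSymbols.FullLevelHomologyTorusLevel
import Mathlib.FieldTheory.Finite.Basic
import HarnessLib

/-!
# The order of the diagonal torus (`T̃ ≃ Fˣ × Fˣ`, `|T̃(ℤ/p)| = (p−1)²`) and complex conjugation `F_∞` on the
# full-level carrier `H₁(Γ₀(M), k[GL₂(ℤ/p)])`

Topic `Literature/NumberTheory/ModularSymbols`; namespace `Literature.NumberTheory.ModularSymbols.FullLevel`; sequel of
`FullLevelHomologyCarrier` / `FullLevelHomologyTorusLevel`.  Definitions with bodies + proved theorems; no named fact,
no `sorry`, no instance, no notation.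

* `diagUnits`, **`diagTorusEquiv F : Fˣ × Fˣ ≃ T̃`**, `natCard_diagTorus` (`|T̃| = |Fˣ|²`), **`natCard_diagTorus_zmod`**
  (`|T̃(ℤ/p)| = (p − 1)²`) — so the hypothesis `[Invertible (|T̃| : k)]` of the up/down dictionary is dischargeable for
  `k = ℤ_p` (`p ∤ (p−1)²`); `Fintype` instances are obtained by the consumer from the equivalence (`Fintype.ofEquiv`).
* Complex conjugation: `epsConj A = εAε⁻¹` (`ε = diag(−1,1)`: `(a b; c d) ↦ (a, −b; −c, d)`), the involution
  **`epsConjHom M : Γ₀(M) →* Γ₀(M)`**, `epsBar p = diag(−1, 1) ∈ GL₂(ℤ/p)`, `redGL_epsConjHom`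
  (`redGL(εγε⁻¹) = ε̄ · redGL γ · ε̄`), the coefficient map `epsCoeffHom` (`δ_x ↦ δ_{ε̄x}`), and
  **`complexConj k p M : H1carrier ⟶ H1carrier`** = `F_∞`, the involution `(τ, x) ↦ (−τ̄, ε̄x)` of
  `Y(K(p)K₀(M))(ℂ) = Γ₀(M)\(ℍ × GL₂(ℤ/p))` on homology (Cremona's `*`-involution `{α,β} ↦ {−ᾱ,−β̄}` upstairs);
  `complexConj_symbol` (`F_∞[γ ⊗ aδ_x] = [εγε⁻¹ ⊗ aδ_{ε̄x}]`), **`complexConj_comm` / `complexConj_H1carrierRep`**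
  (`F_∞` commutes with the `GL₂(ℤ/p)`-action), **`complexConj_comp_complexConj`** (`F_∞² = 1`).
  This is the involution of audit step (S3) of the K-line (route BSD/TeichmullerTwistDescent, crux
  `TwistedPeriodLatticeSaturation`): for `p` odd it splits any `F_∞`-stable `ℤ_p`-lattice into `±`-parts, each
  `GL₂(ℤ/p)`-stable.  Nothing about any elliptic curve is asserted.

## References
* J. E. Cremona, *Algorithms for modular elliptic curves* (1997), §2.1.3 (the action of complex conjugation,
  `{α, β}* = {−ᾱ, −β̄}`, conjugation by `diag(−1, 1)`). [CremonaAlgorithms1997]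
* D. Bump, *Automorphic Forms and Representations* (1997), §4.1 Eq. (1.6) (the torus). [Bump1997]
-/

noncomputable section

namespace Literature.NumberTheory.ModularSymbols

namespace FullLevel

open scoped MatrixGroups
open CategoryTheory CongruenceSubgroup groupHomology Finsupp Matrix
open Literature.Algebra.Homology

/-! ### `T̃ ≃ Fˣ × Fˣ`: finiteness and order `(q − 1)²` of the diagonal torus -/

/-- The diagonal entries of a torus element are units (`det = g₀₀ g₁₁ ≠ 0`). [cite: Bump1997, §4.1 Eq. (1.6)] -/
theorem diag_ne_zero_of_mem_diagTorus {F : Type} [Field F] {g : GL (Fin 2) F} (hg : g ∈ diagTorus F) :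
    (g : Matrix (Fin 2) (Fin 2) F) 0 0 ≠ 0 ∧ (g : Matrix (Fin 2) (Fin 2) F) 1 1 ≠ 0 := by
  have hdet : (g : Matrix (Fin 2) (Fin 2) F).det ≠ 0 := by
    simpa [Matrix.GeneralLinearGroup.val_det_apply] using (Matrix.GeneralLinearGroup.det g).ne_zero
  rw [Matrix.det_fin_two, (mem_diagTorus_iff g).1 hg |>.1, (mem_diagTorus_iff g).1 hg |>.2] at hdet
  simp only [mul_zero, sub_zero] at hdet
  exact ⟨left_ne_zero_of_mul hdet, right_ne_zero_of_mul hdet⟩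

/-- `diag(u, v) ∈ GL₂(F)`. [cite: Bump1997, §4.1 Eq. (1.6)] -/
def diagUnits {F : Type} [Field F] (u : Fˣ × Fˣ) : GL (Fin 2) F :=
  Matrix.GeneralLinearGroup.mkOfDetNeZero !![(u.1 : F), 0; 0, (u.2 : F)]
    (by simp [Matrix.det_fin_two_of, u.1.ne_zero, u.2.ne_zero])

/-- Matrix of `diag(u, v)`. [cite: Bump1997, §4.1 Eq. (1.6)] -/
theorem coe_diagUnits {F : Type} [Field F] (u : Fˣ × Fˣ) :
    (diagUnits u : Matrix (Fin 2) (Fin 2) F) = !![(u.1 : F), 0; 0, (u.2 : F)] := rfl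

/-- `diag(u, v) ∈ T̃`. [cite: Bump1997, §4.1 Eq. (1.6)] -/
theorem diagUnits_mem {F : Type} [Field F] (u : Fˣ × Fˣ) : diagUnits u ∈ diagTorus F := by
  rw [mem_diagTorus_iff, coe_diagUnits]; simp

/-- **`Fˣ × Fˣ ≃ T̃`**, `(u, v) ↦ diag(u, v)` (an equivalence of types; for `F = 𝔽_q` this gives
`|T̃| = (q−1)²`). [cite: Bump1997, §4.1 Eq. (1.6)] -/
def diagTorusEquiv (F : Type) [Field F] : Fˣ × Fˣ ≃ diagTorus F where
  toFun u := ⟨diagUnits u, diagUnits_mem u⟩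
  invFun g := (Units.mk0 _ (diag_ne_zero_of_mem_diagTorus g.2).1, Units.mk0 _ (diag_ne_zero_of_mem_diagTorus g.2).2)
  left_inv u := by
    ext <;> simp [coe_diagUnits]
  right_inv g := by
    apply Subtype.ext
    apply Matrix.GeneralLinearGroup.ext
    intro i j
    have h := (mem_diagTorus_iff g.1).1 g.2
    fin_cases i <;> fin_cases j <;> simp [coe_diagUnits, h.1, h.2]

/-- `|T̃| = |Fˣ|²` (as `Nat.card`; for `F = ℤ/p`: `(p − 1)²`, a unit in `ℤ_p`). [cite: Bump1997, §4.1] -/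
theorem natCard_diagTorus (F : Type) [Field F] : Nat.card (diagTorus F) = Nat.card Fˣ ^ 2 := by
  rw [← Nat.card_congr (diagTorusEquiv F), Nat.card_prod, pow_two]

/-- `|T̃(ℤ/p)| = (p − 1)²`. [cite: Bump1997, §4.1] -/
theorem natCard_diagTorus_zmod (p : ℕ) [Fact p.Prime] : Nat.card (diagTorus (ZMod p)) = (p - 1) ^ 2 := by
  rw [natCard_diagTorus, Nat.card_eq_fintype_card, ZMod.card_units p]

end FullLevel

end Literature.NumberTheory.ModularSymbols

namespace Literature.NumberTheory.ModularSymbols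

namespace FullLevel

open scoped MatrixGroups
open CategoryTheory CongruenceSubgroup groupHomology Finsupp Matrix
open Literature.Algebra.Homology

variable (k : Type) [CommRing k] (p M : ℕ)

/-! ### Complex conjugation `F_∞` on the carrier: `(τ, x) ↦ (−τ̄, εx)`, `ε = diag(−1, 1)` -/

/-- `ε γ ε⁻¹` for `ε = diag(−1, 1)`: `(a b; c d) ↦ (a, −b; −c, d)`, on integer matrices. [cite: CremonaAlgorithms1997, §2.1.3 (the involution `*`)] -/
def epsConj (A : Matrix (Fin 2) (Fin 2) ℤ) : Matrix (Fin 2) (Fin 2) ℤ := !![A 0 0, -A 0 1; -A 1 0, A 1 1]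

/-- `det (ε A ε⁻¹) = det A`. [cite: CremonaAlgorithms1997, §2.1.3] -/
theorem det_epsConj (A : Matrix (Fin 2) (Fin 2) ℤ) : (epsConj A).det = A.det := by
  rw [epsConj, Matrix.det_fin_two_of, Matrix.det_fin_two]; ring

/-- `ε (A B) ε⁻¹ = (ε A ε⁻¹)(ε B ε⁻¹)`. [cite: CremonaAlgorithms1997, §2.1.3] -/
theorem epsConj_mul (A B : Matrix (Fin 2) (Fin 2) ℤ) : epsConj (A * B) = epsConj A * epsConj B := by
  ext i j
  fin_cases i <;> fin_cases j <;> simp [epsConj, Matrix.mul_apply, Fin.sum_univ_two] <;> ring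

/-- `ε (ε A ε⁻¹) ε⁻¹ = A`. [cite: CremonaAlgorithms1997, §2.1.3] -/
theorem epsConj_epsConj (A : Matrix (Fin 2) (Fin 2) ℤ) : epsConj (epsConj A) = A := by
  ext i j
  fin_cases i <;> fin_cases j <;> simp [epsConj]

/-- **The involution `γ ↦ εγε⁻¹` of `Γ₀(M)`** (`ε = diag(−1,1)` normalises `Γ₀(M)`): the action of complex
conjugation on `π₁`. [cite: CremonaAlgorithms1997, §2.1.3] -/
def epsConjHom : Gamma0 M →* Gamma0 M where
  toFun γ := ⟨⟨epsConj ((γ : SL(2, ℤ)) : Matrix (Fin 2) (Fin 2) ℤ), by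
      rw [det_epsConj, Matrix.SpecialLinearGroup.det_coe]⟩, by
    rw [Gamma0_mem]
    show ((-(((γ : SL(2, ℤ)) : Matrix (Fin 2) (Fin 2) ℤ) 1 0) : ℤ) : ZMod M) = 0
    rw [Int.cast_neg, neg_eq_zero]
    exact Gamma0_mem.1 γ.2⟩
  map_one' := by
    apply Subtype.ext; apply Subtype.ext
    ext i j; fin_cases i <;> fin_cases j <;> simp [epsConj]
  map_mul' γ δ := by
    apply Subtype.ext; apply Subtype.ext
    exact epsConj_mul _ _

/-- Entries of `epsConjHom γ`. [cite: CremonaAlgorithms1997, §2.1.3] -/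
theorem coe_epsConjHom (γ : Gamma0 M) :
    (((epsConjHom M γ : Gamma0 M) : SL(2, ℤ)) : Matrix (Fin 2) (Fin 2) ℤ) =
      epsConj ((γ : SL(2, ℤ)) : Matrix (Fin 2) (Fin 2) ℤ) := rfl

/-- `epsConjHom` is an involution. [cite: CremonaAlgorithms1997, §2.1.3] -/
theorem epsConjHom_epsConjHom (γ : Gamma0 M) : epsConjHom M (epsConjHom M γ) = γ := by
  apply Subtype.ext; apply Subtype.ext
  exact epsConj_epsConj _

/-- `epsConjHom ∘ epsConjHom = id`. [cite: CremonaAlgorithms1997, §2.1.3] -/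
theorem epsConjHom_comp_epsConjHom : (epsConjHom M).comp (epsConjHom M) = MonoidHom.id _ :=
  MonoidHom.ext (epsConjHom_epsConjHom M)

variable [Fact p.Prime]

/-- `ε̄ = diag(−1, 1) ∈ GL₂(ℤ/p)`. [cite: CremonaAlgorithms1997, §2.1.3] -/
def epsBar : GL (Fin 2) (ZMod p) := diagUnits (-1, 1)

/-- Matrix of `ε̄`. [cite: CremonaAlgorithms1997, §2.1.3] -/
theorem epsBar_val : ((epsBar p : GL (Fin 2) (ZMod p)) : Matrix (Fin 2) (Fin 2) (ZMod p)) = !![-1, 0; 0, 1] := by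
  rw [epsBar, coe_diagUnits]; simp

/-- `ε̄² = 1`. [cite: CremonaAlgorithms1997, §2.1.3] -/
theorem epsBar_mul_epsBar : epsBar p * epsBar p = 1 := by
  apply Matrix.GeneralLinearGroup.ext
  intro i j
  rw [Units.val_mul, epsBar_val]
  fin_cases i <;> fin_cases j <;> simp [Matrix.mul_apply, Fin.sum_univ_two]

/-- Reduction intertwines the two conjugations: `redGL (εγε⁻¹) = ε̄ · redGL γ · ε̄`. [cite: CremonaAlgorithms1997, §2.1.3] -/
theorem redGL_epsConjHom (γ : Gamma0 M) : redGL p M (epsConjHom M γ) = epsBar p * redGL p M γ * epsBar p := by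
  apply Matrix.GeneralLinearGroup.ext
  intro i j
  rw [Units.val_mul, Units.val_mul, redGL_apply_coe, coe_epsConjHom, epsBar_val]
  simp only [Matrix.mul_apply, Fin.sum_univ_two]
  fin_cases i <;> fin_cases j <;> simp [epsConj, redGL_apply_coe]

/-- The coefficient part of `F_∞`: `δ_x ↦ δ_{ε̄x}`, a morphism `k[G] ⟶ Res_{εγε⁻¹} k[G]`. [cite: CremonaAlgorithms1997, §2.1.3] -/
def epsCoeffHom : coeff k p M ⟶ Rep.res (epsConjHom M) (coeff k p M) :=
  Rep.ofHom ((Finsupp.lmapDomain k k (epsBar p * ·)).intertwiningMap_of_isIntertwiningMap _ _ (fun γ f => by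
    show Finsupp.lmapDomain k k (epsBar p * ·) (PermutationCoeff.permRep k (redGL p M) _ γ f) =
      PermutationCoeff.permRep k (redGL p M) _ (epsConjHom M γ) (Finsupp.lmapDomain k k (epsBar p * ·) f)
    rw [PermutationCoeff.permRep_apply, PermutationCoeff.permRep_apply, redGL_epsConjHom]
    simp only [lmapDomain_apply, ← Finsupp.mapDomain_comp]
    congr 1
    funext x
    simp only [Function.comp_apply, smul_eq_mul, mul_assoc]
    rw [← mul_assoc (epsBar p) (epsBar p) x, epsBar_mul_epsBar, one_mul]))

/-- `epsCoeffHom (aδ_x) = aδ_{ε̄x}`. [cite: CremonaAlgorithms1997, §2.1.3] -/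
theorem epsCoeffHom_single (x : GL (Fin 2) (ZMod p)) (a : k) :
    (epsCoeffHom k p M).hom (single x a) = single (epsBar p * x) a := by
  show Finsupp.lmapDomain k k (epsBar p * ·) (single x a) = _
  simp [mapDomain_single]

/-- **Complex conjugation `F_∞` on `H₁(Γ₀(M), k[GL₂(ℤ/p)])`**: induced by `γ ↦ εγε⁻¹` on `Γ₀(M)` and
`δ_x ↦ δ_{ε̄x}` on coefficients (the involution `(τ, x) ↦ (−τ̄, ε̄x)` of `Γ₀(M)\(ℍ × GL₂(ℤ/p))`; on `X₀(N)`
it is Cremona's `*`: `{α, β} ↦ {−ᾱ, −β̄}`). [cite: CremonaAlgorithms1997, §2.1.3] -/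
def complexConj : H1carrier k p M ⟶ H1carrier k p M :=
  groupHomology.map (epsConjHom M) (epsCoeffHom k p M) 1

/-- `F_∞` on symbols: `F_∞ [γ ⊗ aδ_x] = [εγε⁻¹ ⊗ aδ_{ε̄x}]`. [cite: CremonaAlgorithms1997, §2.1.3] -/
theorem complexConj_symbol (γ : principalLevel p M) (x : GL (Fin 2) (ZMod p)) (a : k) :
    complexConj k p M (symbol k p M γ x a) =
      symbol k p M ⟨epsConjHom M γ.1, (MonoidHom.mem_ker).2 (by
        rw [redGL_epsConjHom, (MonoidHom.mem_ker).1 γ.2, mul_one, epsBar_mul_epsBar])⟩ (epsBar p * x) a := by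
  rw [complexConj, symbol, symbol, PermutationCoeff.stabSymbol, PermutationCoeff.stabSymbol,
    groupHomology.H1π_comp_map_apply (A := coeff k p M) (B := coeff k p M)]
  congr 1
  apply Subtype.ext
  rw [coe_mapCycles₁]
  simp only [ModuleCat.hom_ofHom, LinearMap.coe_comp, Function.comp_apply, lmapDomain_apply, mapDomain_single,
    mapRange.linearMap_apply, mapRange_single]
  congr 1
  exact epsCoeffHom_single k p M x a

/-- `F_∞` commutes with the `GL₂(ℤ/p)`-action. [cite: CremonaAlgorithms1997, §2.1.3] -/
theorem complexConj_comm (g : GL (Fin 2) (ZMod p)) :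
    complexConj k p M ≫ (groupHomology.map (MonoidHom.id _) (PermutationCoeff.rightTranslation (redGL p M) g) 1) =
      (groupHomology.map (MonoidHom.id _) (PermutationCoeff.rightTranslation (redGL p M) g) 1) ≫ complexConj k p M := by
  have h1 := groupHomology.map_comp (A := coeff k p M) (B := coeff k p M) (C := coeff k p M)
    (epsConjHom M) (MonoidHom.id _) (epsCoeffHom k p M) (PermutationCoeff.rightTranslation (redGL p M) g) 1
  have h2 := groupHomology.map_comp (A := coeff k p M) (B := coeff k p M) (C := coeff k p M)
    (MonoidHom.id _) (epsConjHom M) (PermutationCoeff.rightTranslation (redGL p M) g) (epsCoeffHom k p M) 1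
  rw [complexConj, ← h1, ← h2]
  refine groupHomology.map_congr (by rw [MonoidHom.id_comp, MonoidHom.comp_id]) ?_ 1
  apply LinearMap.ext
  intro f
  induction f using Finsupp.induction_linear with
  | zero => simp
  | add f₁ f₂ h₁ h₂ => simp only [map_add, h₁, h₂]
  | single x a =>
    have e1 : (epsCoeffHom k p M).hom (single x a) = single (epsBar p * x) a := epsCoeffHom_single k p M x a
    have e2 : (PermutationCoeff.rightTranslation (k := k) (redGL p M) g).hom (single x a) = single (x * g⁻¹) a :=
      PermutationCoeff.rightTranslation_single (redGL p M) g x a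
    have e3 : (PermutationCoeff.rightTranslation (k := k) (redGL p M) g).hom (single (epsBar p * x) a) =
        single (epsBar p * x * g⁻¹) a := PermutationCoeff.rightTranslation_single (redGL p M) g _ a
    have e4 : (epsCoeffHom k p M).hom (single (x * g⁻¹) a) = single (epsBar p * (x * g⁻¹)) a :=
      epsCoeffHom_single k p M _ a
    calc ((epsCoeffHom k p M ≫ (Rep.resFunctor (epsConjHom M)).map
            (PermutationCoeff.rightTranslation (redGL p M) g)).hom.toLinearMap (single x a))
        = (PermutationCoeff.rightTranslation (k := k) (redGL p M) g).hom ((epsCoeffHom k p M).hom (single x a)) := rfl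
      _ = single (epsBar p * x * g⁻¹) a := by rw [e1, e3]
      _ = single (epsBar p * (x * g⁻¹)) a := by rw [mul_assoc]
      _ = (epsCoeffHom k p M).hom ((PermutationCoeff.rightTranslation (k := k) (redGL p M) g).hom (single x a)) := by
          rw [e2, e4]
      _ = _ := rfl

/-- `F_∞` commutes with the `GL₂(ℤ/p)`-action (pointwise form). [cite: CremonaAlgorithms1997, §2.1.3] -/
theorem complexConj_H1carrierRep (g : GL (Fin 2) (ZMod p)) (z : H1carrier k p M) :
    complexConj k p M (H1carrierRep k p M g z) = H1carrierRep k p M g (complexConj k p M z) := by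
  have h := congrArg (fun f => f.hom z) (complexConj_comm k p M g)
  simp only [ModuleCat.hom_comp, LinearMap.comp_apply] at h
  rw [H1carrierRep, PermutationCoeff.H1RightRep_apply]
  exact h.symm

/-- `F_∞² = 1`. [cite: CremonaAlgorithms1997, §2.1.3] -/
theorem complexConj_comp_complexConj : complexConj k p M ≫ complexConj k p M = 𝟙 _ := by
  have h1 := groupHomology.map_comp (A := coeff k p M) (B := coeff k p M) (C := coeff k p M)
    (epsConjHom M) (epsConjHom M) (epsCoeffHom k p M) (epsCoeffHom k p M) 1
  rw [complexConj, ← h1, ← groupHomology.map_id]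
  refine groupHomology.map_congr (epsConjHom_comp_epsConjHom M) ?_ 1
  apply LinearMap.ext
  intro f
  induction f using Finsupp.induction_linear with
  | zero => simp
  | add f₁ f₂ h₁ h₂ => simp only [map_add, h₁, h₂]
  | single x a =>
    simp only [Rep.hom_comp, Representation.IntertwiningMap.comp_toLinearMap, LinearMap.comp_apply,
      Rep.resMap_hom_toLinearMap, Representation.IntertwiningMap.toLinearMap_apply, Rep.hom_id]
    erw [epsCoeffHom_single, epsCoeffHom_single]
    rw [← mul_assoc, epsBar_mul_epsBar, one_mul]
    rfl

end FullLevel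

end Literature.NumberTheory.ModularSymbols
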